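import Literature.IUT.HodgeArakelov.AbsTopMonoidsGenuineGhatTopology
import Literature.IUT.HodgeArakelov.AbsTopMonoidsGenuineProfiniteGroupifications
import Literature.IUT.HodgeArakelov.AbsTopMonoidsGenuineGhatDensity
import Mathlib.FieldTheory.Galois.Profinite
import Mathlib.Topology.CompactOpen
import Mathlib.Topology.Homeomorph.Lemmas
import HarnessLib

/-!
# [IUTchII] Example 1.8 (vii) `(∗ĝp)` GENUINE, the ind-topology (proofs): the levels `((k̄^×)^J)^∧` are PROFINITE groups and
# the `G_k`-action `G_k × O^ĝp → O^ĝp` is JOINTLY continuous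

S. Mochizuki, *Inter-universal Teichmüller theory II*, §1, Example 1.8 (vii), kurims manuscript (Dec. 2020) p. 40 ("by
considering inductive limits of profinite completions of the `J`-invariants [as `J` ranges over the open subgroups of `G`]
… we obtain … `(G ↷ O^ĝp(G))` [an ind-topological monoid equipped with a topological group action]")
[claim: Mochizuki2012, status: disputed] (IUTchII §1 Ex 1.8 (vii), kurims p.40); J. Neukirch, *Algebraic Number Theory*
(1999) Ch. IV §2 p. 274 (profinite completions) [cite: NeukirchANT1999, Ch. IV §2 p.274]; J.-P. Serre, *Cohomologie
galoisienne*, II §5.1 (a) (`L^×/(L^×)ⁿ` finite for a local field `L`) [cite: SerreGaloisCohomology1997, II §5.1 (a)].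
abc-iut cell, layer L6, row «GHATGP-TOPOLOGY» (abc-iut-L6-lead gen 5 GO §F v1.19ay (1), 2026-08-26T16:25:36Z), PROOF-ONLY
sequel 3/3 of `AbsTopMonoidsGenuineGhatTopology.lean`; seat abc-iut-L6-d2 (gen 7).  Nodes IUTchII:Ex1.8(vii),
IUTchII:Rmk1.11.1(i), IUTchII:Rmk1.11.3(ii).

* **The levels are PROFINITE**: `compactSpace_levelGroup` — `((k̄^×)^J)^∧` is COMPACT for `J` open (abc-iut-L6-d2 gen 6's
  `finite_level_quot`, p447651: `(k̄^×)^J/((k̄^×)^J)ⁿ` is finite since `k̄^J/k` is a finite extension of an MLF — through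
  `PowCompletion.compactSpace_of_finite`, Tychonoff), Hausdorff, totally disconnected, a topological group
  (`levelGroup_profinite`); the transition maps are continuous (`continuous_levelMap`).  So `O^ĝp = lim→_J ((k̄^×)^J)^∧` with
  the topology of the def file IS an inductive limit of profinite groups along continuous injections — print's "inductive
  limit of profinite completions", on the nose.
* **Open stabilisers**: `galActOghat_ofLevel_eq_of_mem` — `σ ∈ J` FIXES the image of the level `J` in `O^ĝp` (it fixes the
  `J`-invariants pointwise and `σJσ⁻¹ = J`).
* **JOINT continuity of the `G_k`-action**: `continuous_galActOghat_uncurry` — `O^ĝp × G_k → O^ĝp`, `(z, σ) ↦ σ̂ z` is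
  continuous for the colimit topology on `O^ĝp` and the Krull topology on `G_k = Gal(k̄/k)`: on each level the map is locally
  `(x, σ) ↦ σ̂₀ x` on the open set `level × σ₀J` (open stabilisers), and the passage from `Σ_J level` to the quotient
  `O^ĝp` in the presence of the factor `G_k` uses that `G_k` is (locally) compact (`IsQuotientMap.continuous_lift_prod_left`).
  At the all-fields-genuine producer: `AbsTopMonoids.continuous_genuineGhatAct_uncurry` (`G × O^ĝp(G) → O^ĝp(G)` jointly
  continuous through the identification `theta : G ≃ₜ* Gal(k̄/k)`) — "topological group action" in the strong sense.

HONEST FRAMING: classical topology / infinite Galois theory over OUR typed objects, every input PROVED in the tree;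
record-anchored to a disputed corpus through the locators only; nothing here bears on [IUTchIII] Cor. 3.12; typed ≠ proved
elsewhere.
-/

set_option autoImplicit false

noncomputable section

namespace Literature.IUT.HodgeArakelov

open CategoryTheory Topology
open Literature.AnabelianGeometry.AbsoluteAnabelian

namespace AbsTopMonoids.Genuine

variable (C : MLFClosure.{0})

/-! ## The levels are profinite groups; the transition maps are continuous -/

/-- **`((k̄^×)^J)^∧` is COMPACT** for `J ⊆ Gal(k̄/k)` open: every `(k̄^×)^J/((k̄^×)^J)ⁿ` is finite (`finite_level_quot`), so the
power completion is a closed subgroup of a product of finite discrete groups. [cite: NeukirchANT1999, Ch. IV §2 p.274] -/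
theorem compactSpace_levelGroup (i : GhatLevel C) : CompactSpace (levelGroup C i) :=
  PowCompletion.compactSpace_of_finite (finite_level_quot C i.J)

/-- **The levels `((k̄^×)^J)^∧` are PROFINITE GROUPS**: compact, Hausdorff, totally disconnected topological groups.
[claim: Mochizuki2012, status: disputed] (IUTchII §1 Ex 1.8 (vii), kurims p.40) -/
theorem levelGroup_profinite (i : GhatLevel C) :
    CompactSpace (levelGroup C i) ∧ T2Space (levelGroup C i) ∧ TotallyDisconnectedSpace (levelGroup C i) ∧
      IsTopologicalGroup (levelGroup C i) :=
  ⟨compactSpace_levelGroup C i, inferInstance, inferInstance, inferInstance⟩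

/-- The transition maps `((k̄^×)^{J})^∧ → ((k̄^×)^{J'})^∧` (`J' ⊆ J`) are continuous. [claim: Mochizuki2012, status: disputed] (IUTchII §1 Ex 1.8 (vii), kurims p.40) -/
theorem continuous_levelMap (i j : GhatLevel C) (h : i ≤ j) : Continuous (levelMap C i j h) :=
  PowCompletion.continuous_of_isLocallyConstant fun n =>
    (PowCompletion.isLocallyConstant_component n).comp (PowCompletion.mapLevel _ n)

/-- The image of a level is compact in `O^ĝp`. [claim: Mochizuki2012, status: disputed] (IUTchII §1 Ex 1.8 (vii), kurims p.40) -/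
theorem isCompact_range_ofLevel (i : GhatLevel C) : IsCompact (Set.range (ofLevel C i)) := by
  haveI := compactSpace_levelGroup C i
  exact isCompact_range (continuous_ofLevel C i)

/-! ## Open stabilisers: `σ ∈ J` fixes the level `J` -/

/-- **Open stabilisers**: an element `σ` of the open subgroup `J` FIXES the image of `((k̄^×)^J)^∧` in `O^ĝp` (it acts
trivially on the `J`-invariant units and `σJσ⁻¹ = J`) — for ANY open `J` (abc-iut-L6-d2 gen 6's `galActOghat_ofLevel_of_mem`,
p449965, is the case of a NORMAL open level). [claim: Mochizuki2012, status: disputed] (IUTchII §1 Ex 1.8 (vii), kurims p.40) -/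
theorem galActOghat_ofLevel_eq_of_mem (i : GhatLevel C) (σ : C.K ≃ₐ[C.k] C.K) (hσ : σ ∈ (i.J : Subgroup (C.K ≃ₐ[C.k] C.K)))
    (x : levelGroup C i) : galActOghat C σ (ofLevel C i x) = ofLevel C i x := by
  rw [galActOghat_apply, transportOghat_ofLevel]
  have hle : i ≤ GhatLevel.transport C (conjAut C σ) i := by
    intro γ hγ
    rw [GhatLevel.mem_transport_iff] at hγ
    have h := (conjAut C σ).apply_symm_apply γ
    rw [conjAut_apply] at h
    rw [← h]
    exact Subgroup.mul_mem _ (Subgroup.mul_mem _ hσ hγ) (Subgroup.inv_mem _ hσ)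
  rw [← ofLevel_levelMap C hle]
  congr 1
  exact congrFun (congrArg DFunLike.coe
    (PowCompletion.map_congr fun a => Subtype.ext (Units.ext (a.2 σ hσ)))) x

/-! ## Joint continuity of `O^ĝp × G_k → O^ĝp` -/

/-- `x ↦ σ̂ [x]` on a level is continuous (`σ̂` and the structure map are). [claim: Mochizuki2012, status: disputed] (IUTchII §1 Ex 1.8 (vii), kurims p.40) -/
theorem continuous_galActOghat_ofLevel (σ : C.K ≃ₐ[C.k] C.K) (i : GhatLevel C) :
    Continuous fun x : levelGroup C i => galActOghat C σ (ofLevel C i x) := by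
  simp_rw [galActOghat_apply, transportOghat_ofLevel]
  exact (continuous_ofLevel C _).comp
    (PowCompletion.continuous_of_isLocallyConstant fun n =>
      (PowCompletion.isLocallyConstant_component n).comp (PowCompletion.mapLevel _ n))

/-- On each level the action map `((k̄^×)^J)^∧ × G_k → O^ĝp`, `(x, σ) ↦ σ̂ [x]`, is JOINTLY continuous: near `(x₀, σ₀)` —
on the open set `level × σ₀J` — it is `(x, σ) ↦ σ̂₀ [x]` (open stabilisers). [claim: Mochizuki2012, status: disputed] (IUTchII §1 Ex 1.8 (vii), kurims p.40) -/
theorem continuous_galActOghat_ofLevel_uncurry (i : GhatLevel C) :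
    Continuous fun p : levelGroup C i × (C.K ≃ₐ[C.k] C.K) => galActOghat C p.2 (ofLevel C i p.1) := by
  refine continuous_iff_continuousAt.mpr fun q => ?_
  obtain ⟨x₀, σ₀⟩ := q
  have hcont : Continuous fun p : levelGroup C i × (C.K ≃ₐ[C.k] C.K) => galActOghat C σ₀ (ofLevel C i p.1) :=
    (continuous_galActOghat_ofLevel C σ₀ i).comp continuous_fst
  refine hcont.continuousAt.congr_of_eventuallyEq ?_
  have hU : IsOpen {p : levelGroup C i × (C.K ≃ₐ[C.k] C.K) | σ₀⁻¹ * p.2 ∈ (i.J : Subgroup (C.K ≃ₐ[C.k] C.K))} :=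
    (i.J.isOpen.preimage (continuous_const.mul continuous_id)).preimage continuous_snd
  have hmem : (x₀, σ₀) ∈ {p : levelGroup C i × (C.K ≃ₐ[C.k] C.K) | σ₀⁻¹ * p.2 ∈ (i.J : Subgroup (C.K ≃ₐ[C.k] C.K))} := by
    change σ₀⁻¹ * σ₀ ∈ (i.J : Subgroup (C.K ≃ₐ[C.k] C.K))
    rw [inv_mul_cancel]
    exact Subgroup.one_mem _
  filter_upwards [hU.mem_nhds hmem] with p hp
  calc galActOghat C p.2 (ofLevel C i p.1)
      = galActOghat C (σ₀ * (σ₀⁻¹ * p.2)) (ofLevel C i p.1) := by rw [mul_inv_cancel_left]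
    _ = galActOghat C σ₀ (galActOghat C (σ₀⁻¹ * p.2) (ofLevel C i p.1)) := by rw [map_mul, MulAut.mul_apply]
    _ = galActOghat C σ₀ (ofLevel C i p.1) := by rw [galActOghat_ofLevel_eq_of_mem C i _ hp]

/-- **JOINT CONTINUITY of the `G_k`-action on `O^ĝp`**: `O^ĝp × Gal(k̄/k) → O^ĝp`, `(z, σ) ↦ σ̂ z`, is continuous (colimit
topology on `O^ĝp`, Krull topology on `Gal(k̄/k)`; `Gal(k̄/k)` compact, so `− × Gal(k̄/k)` preserves the quotient map
`Σ_J ((k̄^×)^J)^∧ → O^ĝp`). [claim: Mochizuki2012, status: disputed] (IUTchII §1 Ex 1.8 (vii), kurims p.40) -/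
theorem continuous_galActOghat_uncurry :
    Continuous fun p : Oghat C × (C.K ≃ₐ[C.k] C.K) => galActOghat C p.2 p.1 := by
  haveI : IsGalois C.k C.K := {}
  refine (isQuotientMap_sigmaOfLevel C).continuous_lift_prod_left
    (g := fun p : Oghat C × (C.K ≃ₐ[C.k] C.K) => galActOghat C p.2 p.1) ?_
  have hc : Continuous ((fun q : Σ i : GhatLevel C, levelGroup C i × (C.K ≃ₐ[C.k] C.K) =>
      galActOghat C q.2.2 (ofLevel C q.1 q.2.1)) ∘ Homeomorph.sigmaProdDistrib) :=
    (continuous_sigma_iff.mpr fun i => continuous_galActOghat_ofLevel_uncurry C i).comp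
      (Homeomorph.sigmaProdDistrib).continuous
  refine hc.congr fun p => ?_
  rfl

/-- The same with the factors swapped: `Gal(k̄/k) × O^ĝp → O^ĝp`, `(σ, z) ↦ σ̂ z`, is continuous.
[claim: Mochizuki2012, status: disputed] (IUTchII §1 Ex 1.8 (vii), kurims p.40) -/
theorem continuous_galActOghat_uncurry' :
    Continuous fun p : (C.K ≃ₐ[C.k] C.K) × Oghat C => galActOghat C p.1 p.2 := by
  have h := (continuous_galActOghat_uncurry C).comp (continuous_swap (X := (C.K ≃ₐ[C.k] C.K)) (Y := Oghat C))
  exact h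

end AbsTopMonoids.Genuine

/-! ## At the all-fields-genuine producer: `G × O^ĝp(G) → O^ĝp(G)` is jointly continuous -/

section Genuine

open AbsTopMonoids AbsTopMonoids.Genuine

variable (S : ThetaSetting.{0}) (C : MLFClosure.{0}) (ε : S.Gk ≃ₜ* (ModelMLFGaloisData.galois C.k C.K).tmPair.Pi)

/-- **"Topological group action" of `G` on the ind-topological `O^ĝp(G)` at the genuine `(∗ĝp)`**: the action map
`G × O^ĝp(G) → O^ĝp(G)`, `(g, z) ↦ g·z`, is JOINTLY continuous (`g` acts through `theta : G ≃ₜ* Gal(k̄/k)`).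
[claim: Mochizuki2012, status: disputed] (IUTchII §1 Ex 1.8 (vii), kurims p.40) -/
theorem AbsTopMonoids.continuous_genuineGhatAct_uncurry (G : IsoClass S.Gk) :
    Continuous fun p : G.G × Genuine.Oghat C => AbsTopMonoids.genuineGhatAct S C ε G p.1 p.2 := by
  simp_rw [AbsTopMonoids.genuineGhatAct_apply]
  have h := (continuous_galActOghat_uncurry' C).comp
    (((theta C ε G).continuous.comp continuous_fst).prodMk continuous_snd :
      Continuous fun p : G.G × Genuine.Oghat C => (theta C ε G p.1, p.2))
  exact h

end Genuine

end Literature.IUT.HodgeArakelov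

end
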